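import Mathlib
import HarnessLib
import Literature.Analysis.FluidPDE.ClassicalSolution
import Literature.Analysis.FluidPDE.ClassicalSolutionCalculus
import Literature.Analysis.FluidPDE.ClassicalSolutionProofs
import Literature.Analysis.FluidPDE.RapidDecayLemmas
import Literature.Analysis.FluidPDE.NSVorticityHelicityProofs
import Literature.Analysis.FluidPDE.HydrodynamicImpulse
import Literature.Analysis.FluidPDE.HydrodynamicImpulseVector
import Literature.Analysis.FluidPDE.VectorCalculus
import Literature.Analysis.FluidPDE.Vorticity
import Literature.Analysis.FluidPDE.VorticityEquation
import Literature.Analysis.FluidPDE.WholeSpaceIBP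
import Literature.Analysis.FluidPDE.PineauVicolEnstrophy
import Literature.Analysis.FluidPDE.LocalBiotSavartCalculus
import Literature.Analysis.FluidPDE.NewtonKernel
import Literature.Analysis.FluidPDE.LeiZhang2011Cutoff
import Literature.Analysis.FluidPDE.TaoEnstrophyLocalisation
import Literature.Analysis.FluidPDE.EnergyToolkit
import Literature.Analysis.FluidPDE.EnergyUniqueness
import Literature.Analysis.FluidPDE.VorticityCalculus
import Literature.Analysis.FluidPDE.VectorCalculusProofs
import Literature.Analysis.FluidPDE.LeiZhang2011Proofs
import Summits.NavierStokesRegularity.NavierStokesRegularity.Theorems.EulerMelnikovDssPeriodMomentLawsAngularImpulseTools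

/-!
# Period moment laws of the rescaled Euler–Leray system, III-b: the viscous and pressure terms of the
  ANGULAR-IMPULSE law (tools for item stmt-NavierStokesRegularity-1419, law (ii))

Two more whole-space identities for the angular-impulse law `A' = (3ε/2) A` of the rescaled
Euler–Leray system (see part III-a `…AngularImpulseTools` and part III-c `…AngularImpulse`):

* `integral_cross_laplacian_apply_eq_zero` — **`∫ y × ΔV = 0`** for a divergence-free `C²` field with
  `‖DV‖, ‖D²V‖ ≤ C(1+|y|)⁻⁶`: `ΔV = −curl curl V` (tree `laplacian_eq_neg_curl_curl`) and the
  hydrodynamic impulse of the integrable divergence-free field `curl V` vanishes (tree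
  `integral_cross_curl_eq_zero_of_isDivFree`, Saffman (3.2.11) + (3.2.15));
* `integral_cross_gradient_apply_eq_zero` — **`∫ y × ∇q = 0`** for `q ∈ C¹` whose GRADIENT decays
  (`‖∇q‖ ≤ C(1+|y|)⁻⁵`; no decay of `q`): against the RADIAL cut-off `θ_R = radialCutoff R (2R)` of the
  tree, `∫ θ_R ⟪eᵢ × y, ∇q⟫ = −∫ q div(θ_R (eᵢ × y)) = 0` exactly — `div(eᵢ × y) = 0` and `Dθ_R(y)`
  is a multiple of `⟪y, ·⟫`, which annihilates `eᵢ × y` — then `R → ∞` by dominated convergence;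
* small helpers: `integrable_cross_apply_of_norm_le`, `integral_apply_eq`, the triple product
  `(y × g)ᵢ = ⟪eᵢ × y, g⟫`, `⟪y, eᵢ × y⟫ = 0`, `div(eᵢ × y) = 0`.

HONEST FRAMING: calculus identities about HYPOTHETICAL smooth decaying fields; nothing here bears on
NS regularity.

References: P. G. Saffman, *Vortex Dynamics* (1992), §3.2 (3.2.11)–(3.2.15), §3.5
[cite: Saffman1992, §3.2 (3.2.11)–(3.2.15)].
-/

noncomputable section

set_option linter.dupNamespace false

namespace Summit.NavierStokesRegularity.NavierStokesRegularity.Theorems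

namespace PeriodMomentLaws

open MeasureTheory Set Filter Topology InnerProductSpace Literature.Analysis.FluidPDE
open scoped RealInnerProductSpace NNReal ENNReal ContDiff Laplacian

/-! ### Integrability helpers and the viscous and pressure identities -/

/-- A continuous field of the form `y ↦ (y × g(y))ᵢ` with `‖g(y)‖ ≤ C (1 + ‖y‖)⁻⁵` is integrable on `ℝ³`.
[folklore] -/
theorem integrable_cross_apply_of_norm_le {g : EuclideanSpace ℝ (Fin 3) → EuclideanSpace ℝ (Fin 3)}
    (hg : Continuous g) {C : ℝ} (hC : 0 ≤ C) (h : ∀ y, ‖g y‖ ≤ C * (1 + ‖y‖) ^ (-(5 : ℝ))) (i : Fin 3) :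
    Integrable (fun y : EuclideanSpace ℝ (Fin 3) => cross y (g y) i) := by
  refine integrable_of_norm_le_pow_mul_rpow
    ((continuous_apply i).comp (PiLp.continuous_ofLp 2 _) |>.comp
      (crossCLM.continuous₂.comp (continuous_id.prodMk hg)))
    (C := C) (k := 1) (a := 5) hC (by norm_num) fun x => ?_
  have hc : |cross x (g x) i| ≤ ‖cross x (g x)‖ := by simpa using PiLp.norm_apply_le (cross x (g x)) i
  rw [Real.norm_eq_abs]
  calc |cross x (g x) i| ≤ ‖x‖ * ‖g x‖ := hc.trans (norm_cross_le_norm_mul_norm _ _)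
    _ ≤ ‖x‖ * (C * (1 + ‖x‖) ^ (-(5 : ℝ))) := by gcongr; exact h x
    _ = C * (‖x‖ ^ 1 * (1 + ‖x‖) ^ (-(5 : ℝ))) := by ring

/-- Components commute with the Bochner integral on `ℝ³`-valued integrands. [folklore] -/
theorem integral_apply_eq (f : EuclideanSpace ℝ (Fin 3) → EuclideanSpace ℝ (Fin 3))
    (hf : Integrable f) (i : Fin 3) : (∫ y, f y) i = ∫ y, f y i := by
  have h := ((EuclideanSpace.proj i : EuclideanSpace ℝ (Fin 3) →L[ℝ] ℝ).integral_comp_comm hf).symm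
  simpa using h

/-- **`∫ y × ΔV = 0`** (componentwise) for a divergence-free `C²` field with
`‖DV‖, ‖D²V‖ ≤ C (1 + ‖y‖)⁻⁶`: `ΔV = −curl curl V` (tree `laplacian_eq_neg_curl_curl`) and the
hydrodynamic impulse of the integrable divergence-free field `curl V` vanishes (tree
`integral_cross_curl_eq_zero_of_isDivFree`, Saffman (3.2.11) + (3.2.15)). [cite: Saffman1992, §3.2 (3.2.11)–(3.2.15)] -/
theorem integral_cross_laplacian_apply_eq_zero {V : EuclideanSpace ℝ (Fin 3) → EuclideanSpace ℝ (Fin 3)}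
    {C : ℝ} (hV : ContDiff ℝ 2 V) (hdiv : VectorCalculus.IsDivFree V)
    (hC : 0 ≤ C) (h1 : ∀ y, ‖fderiv ℝ V y‖ ≤ C * (1 + ‖y‖) ^ (-(6 : ℝ)))
    (h2 : ∀ y, ‖fderiv ℝ (fderiv ℝ V) y‖ ≤ C * (1 + ‖y‖) ^ (-(6 : ℝ))) (i : Fin 3) :
    ∫ y, cross y ((Δ (V)) y) i = 0 := by
  have hV1 : ContDiff ℝ 1 V := hV.of_le one_le_two
  have hω1 : ContDiff ℝ 1 (curl V) := contDiff_curl (n := 1) (by exact_mod_cast hV)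
  have hωdiv : VectorCalculus.IsDivFree (curl V) := fun y => divergence_curl_eq_zero_holds V hV y
  have hκ : 0 ≤ ‖curlCLM‖ := ContinuousLinearMap.opNorm_nonneg _
  -- `‖D curl V‖ ≤ ‖curlCLM‖ ‖D²V‖`
  have hDω : ∀ y, ‖fderiv ℝ (curl V) y‖ ≤ ‖curlCLM‖ * ‖fderiv ℝ (fderiv ℝ V) y‖ := by
    intro y
    have hd : DifferentiableAt ℝ (fderiv ℝ V) y :=
      ((hV.fderiv_right (m := 1) (by norm_num)).differentiable one_ne_zero) y
    have h := curlCLM.hasFDerivAt.comp y hd.hasFDerivAt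
    rw [curl_eq_curlCLM_comp V, h.fderiv]
    exact ContinuousLinearMap.opNorm_comp_le _ _
  have hωint : Integrable (curl V) := by
    refine integrable_of_norm_le_rpow_neg (continuous_curl hV1) (C := ‖curlCLM‖ * C) (r := 6)
      (by rw [finrank_euclideanSpace_fin]; norm_num) fun x => ?_
    calc ‖curl V x‖ ≤ ‖curlCLM‖ * ‖fderiv ℝ V x‖ := norm_curl_le V x
      _ ≤ ‖curlCLM‖ * (C * (1 + ‖x‖) ^ (-(6 : ℝ))) := by gcongr; exact h1 x
      _ = ‖curlCLM‖ * C * (1 + ‖x‖) ^ (-(6 : ℝ)) := by ring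
  have hcc : ∀ x, ‖curl (curl V) x‖ ≤ ‖curlCLM‖ * ‖curlCLM‖ * C * (1 + ‖x‖) ^ (-(5 : ℝ)) := by
    intro x
    have hw : (1 + ‖x‖) ^ (-(6 : ℝ)) ≤ (1 + ‖x‖) ^ (-(5 : ℝ)) :=
      Real.rpow_le_rpow_of_exponent_le (by linarith [norm_nonneg x]) (by norm_num)
    calc ‖curl (curl V) x‖ ≤ ‖curlCLM‖ * ‖fderiv ℝ (curl V) x‖ := norm_curl_le _ x
      _ ≤ ‖curlCLM‖ * (‖curlCLM‖ * (C * (1 + ‖x‖) ^ (-(6 : ℝ)))) := by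
          gcongr; exact (hDω x).trans (by gcongr; exact h2 x)
      _ ≤ ‖curlCLM‖ * (‖curlCLM‖ * (C * (1 + ‖x‖) ^ (-(5 : ℝ)))) := by gcongr
      _ = ‖curlCLM‖ * ‖curlCLM‖ * C * (1 + ‖x‖) ^ (-(5 : ℝ)) := by ring
  have hIi : ∀ j : Fin 3, Integrable (fun x : EuclideanSpace ℝ (Fin 3) => cross x (curl (curl V) x) j) :=
    fun j => integrable_cross_apply_of_norm_le (continuous_curl hω1) (by positivity) hcc j
  have hI : Integrable (fun x : EuclideanSpace ℝ (Fin 3) => cross x (curl (curl V) x)) :=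
    Integrable.of_eval_piLp hIi
  have h0 := integral_cross_curl_eq_zero_of_isDivFree hω1 hωdiv hωint hI
  have hcomp : ∫ y, cross y (curl (curl V) y) i = 0 := by
    rw [← eval_integral_piLp hIi i, h0]
    rfl
  have hpt : ∀ y, cross y ((Δ (V)) y) i = -(cross y (curl (curl V) y) i) := by
    intro y
    rw [laplacian_eq_neg_curl_curl hV hdiv y, ← crossCLM_apply, map_neg]
    rfl
  simp_rw [hpt, integral_neg, hcomp, neg_zero]

/-- The triple product behind the test fields `eᵢ × y`: `(y × g)ᵢ = ⟪eᵢ × y, g⟫`. [folklore] -/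
theorem cross_apply_eq_inner_cross_single (y g : EuclideanSpace ℝ (Fin 3)) (i : Fin 3) :
    cross y g i = ⟪cross (EuclideanSpace.single i (1 : ℝ)) y, g⟫ := by
  fin_cases i <;> simp [cross, cross_apply, PiLp.inner_apply, Fin.sum_univ_three] <;> ring

/-- `⟪y, eᵢ × y⟫ = 0`. [folklore] -/
theorem inner_self_cross_single (y : EuclideanSpace ℝ (Fin 3)) (i : Fin 3) :
    ⟪y, cross (EuclideanSpace.single i (1 : ℝ)) y⟫ = 0 := by
  fin_cases i <;> simp [cross, cross_apply, PiLp.inner_apply, Fin.sum_univ_three] <;> ring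

/-- The Killing field `y ↦ eᵢ × y` is divergence free. [folklore] -/
theorem divergence_cross_single_eq_zero (i : Fin 3) (x : EuclideanSpace ℝ (Fin 3)) :
    VectorCalculus.divergence (fun y : EuclideanSpace ℝ (Fin 3) =>
      cross (EuclideanSpace.single i (1 : ℝ)) y) x = 0 := by
  have hL : (fun y : EuclideanSpace ℝ (Fin 3) => cross (EuclideanSpace.single i (1 : ℝ)) y) =
      fun y => crossCLM (EuclideanSpace.single i (1 : ℝ)) y := by
    funext y; rw [crossCLM_apply]
  rw [hL, divergence_eq_sum_inner_fderiv (EuclideanSpace.basisFun (Fin 3) ℝ),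
    (crossCLM (EuclideanSpace.single i (1 : ℝ))).fderiv]
  fin_cases i <;> simp [Fin.sum_univ_three, cross, cross_apply, PiLp.inner_apply]

/-- **`∫ y × ∇q = 0`** (componentwise) for `q ∈ C¹` whose GRADIENT decays, `‖∇q‖ ≤ C(1 + ‖y‖)⁻⁵` —
no decay of `q` itself is needed. Against the RADIAL cut-off `θ_R = radialCutoff R (2R)` of the tree,
`∫ θ_R ⟪eᵢ × y, ∇q⟫ = −∫ q div(θ_R (eᵢ × y)) = 0` exactly, because `div(eᵢ × y) = 0` and
`Dθ_R(y)` is a multiple of `⟪y, ·⟫`, which annihilates `eᵢ × y`; then `R → ∞` by dominated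
convergence. [folklore] -/
theorem integral_cross_gradient_apply_eq_zero {q : EuclideanSpace ℝ (Fin 3) → ℝ} (hq : ContDiff ℝ 1 q)
    {C : ℝ} (hC : 0 ≤ C) (hg : ∀ y, ‖gradient q y‖ ≤ C * (1 + ‖y‖) ^ (-(5 : ℝ))) (i : Fin 3) :
    ∫ y, cross y (gradient q y) i = 0 := by
  set e : EuclideanSpace ℝ (Fin 3) := EuclideanSpace.single i (1 : ℝ) with he
  -- the cut-off identities `∫ θ_R (y × ∇q)ᵢ = 0`
  have hcut : ∀ R : ℝ, 0 < R → ∫ y, radialCutoff R (2 * R) y * cross y (gradient q y) i = 0 := by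
    intro R hR
    have hR2 : R < 2 * R := by linarith
    set u : EuclideanSpace ℝ (Fin 3) → EuclideanSpace ℝ (Fin 3) :=
      fun y => radialCutoff R (2 * R) y • cross e y with hu
    have hθ1 : ContDiff ℝ 1 (radialCutoff R (2 * R) : EuclideanSpace ℝ (Fin 3) → ℝ) :=
      radialCutoff_contDiff R (2 * R)
    have hcr : ContDiff ℝ 1 (fun y : EuclideanSpace ℝ (Fin 3) => cross e y) := by
      have hL : (fun y : EuclideanSpace ℝ (Fin 3) => cross e y) = fun y => crossCLM e y := by
        funext y; rw [crossCLM_apply]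
      rw [hL]
      exact (crossCLM e).contDiff
    have hu1 : ContDiff ℝ 1 u := hθ1.smul hcr
    have huc : HasCompactSupport u := by
      refine HasCompactSupport.intro (isCompact_closedBall (0 : EuclideanSpace ℝ (Fin 3)) (2 * R))
        fun y hy => ?_
      rw [mem_closedBall_zero_iff, not_le] at hy
      simp only [hu, radialCutoff_eq_zero hR.le hR2 hy.le, zero_smul]
    -- `div u = 0`
    have hdivu : ∀ y, VectorCalculus.divergence u y = 0 := by
      intro y
      have hθd : DifferentiableAt ℝ (radialCutoff R (2 * R) : EuclideanSpace ℝ (Fin 3) → ℝ) y :=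
        (hθ1.differentiable one_ne_zero) y
      have hcd : DifferentiableAt ℝ (fun y : EuclideanSpace ℝ (Fin 3) => cross e y) y :=
        (hcr.differentiable one_ne_zero) y
      rw [hu, divergence_smul_apply hθd hcd, divergence_cross_single_eq_zero i y, mul_zero, zero_add,
        gradient, real_inner_comm, InnerProductSpace.toDual_symm_apply,
        (LeiZhang2011.hasFDerivAt_radialCutoff R (2 * R) y).fderiv]
      have h0 : ⟪y, cross e y⟫ = 0 := by rw [he]; exact inner_self_cross_single y i
      simp [innerSL_apply_apply, h0]
    have hibp := integral_mul_divergence_add_eq_zero_right hq hu1 huc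
    have hz : ∫ y, q y * VectorCalculus.divergence u y = 0 := by simp [hdivu]
    rw [hz, zero_add] at hibp
    rw [← hibp]
    refine integral_congr_ae (Eventually.of_forall fun y => ?_)
    show radialCutoff R (2 * R) y * cross y (gradient q y) i = ⟪u y, gradient q y⟫
    rw [hu]
    simp only
    rw [real_inner_smul_left, cross_apply_eq_inner_cross_single]
  -- dominated convergence `R = n + 1 → ∞`
  have hgc : Continuous (gradient q) := continuous_gradient_of_contDiff hq
  have hint : Integrable (fun y : EuclideanSpace ℝ (Fin 3) => cross y (gradient q y) i) :=
    integrable_cross_apply_of_norm_le hgc hC hg i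
  have hlim : Tendsto (fun n : ℕ => ∫ y, radialCutoff ((n : ℝ) + 1) (2 * ((n : ℝ) + 1)) y *
      cross y (gradient q y) i) atTop (𝓝 (∫ y, cross y (gradient q y) i)) := by
    refine tendsto_integral_of_dominated_convergence (fun y => ‖cross y (gradient q y) i‖)
      (fun n => ?_) hint.norm (fun n => Eventually.of_forall fun y => ?_)
      (Eventually.of_forall fun y => ?_)
    · exact (((radialCutoff_contDiff (n := 1) ((n : ℝ) + 1) (2 * ((n : ℝ) + 1))).continuous).mul
        ((continuous_apply i).comp (PiLp.continuous_ofLp 2 _) |>.comp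
          (crossCLM.continuous₂.comp (continuous_id.prodMk hgc)))).aestronglyMeasurable
    · rw [norm_mul, Real.norm_eq_abs]
      exact mul_le_of_le_one_left (norm_nonneg _) (abs_radialCutoff_le_one _ _ _)
    · have hev : ∀ᶠ n : ℕ in atTop, radialCutoff ((n : ℝ) + 1) (2 * ((n : ℝ) + 1)) y = 1 := by
        refine (tendsto_natCast_atTop_atTop.eventually_ge_atTop ‖y‖).mono fun n hn => ?_
        exact radialCutoff_eq_one (by positivity) (by linarith) (by linarith)
      refine Tendsto.congr' (hev.mono fun n hn => by simp only [hn, one_mul]) tendsto_const_nhds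
  have hzero : (fun n : ℕ => ∫ y, radialCutoff ((n : ℝ) + 1) (2 * ((n : ℝ) + 1)) y *
      cross y (gradient q y) i) = fun _ => (0 : ℝ) :=
    funext fun n => hcut _ (by positivity)
  rw [hzero] at hlim
  exact (tendsto_nhds_unique tendsto_const_nhds hlim).symm


end PeriodMomentLaws

end Summit.NavierStokesRegularity.NavierStokesRegularity.Theorems

end
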